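import Literature.Analysis.Calculus.DilationEquivariantGermLinear
import Literature.Analysis.Complex.HolomorphicBanach
import Mathlib.Geometry.Manifold.MFDeriv.Atlas
import Mathlib.Geometry.Manifold.MFDeriv.FDeriv
import Mathlib.Geometry.Manifold.IsManifold.Basic
import Mathlib.Analysis.Calculus.InverseFunctionTheorem.FDeriv
import HarnessLib

/-!
# Doubling-equivariant holomorphic maps into a complex manifold factor LINEARLY through a lattice-periodic immersion

[Milnor2006, §8 Thm. 8.2 (Koenigs: a germ commuting with a dilation is linear) and Cor. 8.4 (spreading along orbits)],
applied to complex tori in the spirit of [BirkenhakeLange2004, §1.2 Prop. 1.2.1] (holomorphic maps of complex tori lift to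
affine-linear maps of the universal covers).  THE STATEMENT (organ B4 «DBLADD» of the HOME-only road-B skeleton for the
relative exponential of an abelian scheme, floor-0 programme P6, crux `HLiu418`; statement of record = the body of
`RoadB.DBLADD`, LA7-plan (g2) 2026-09-02, binder for binder): `M` a Hausdorff complex manifold modelled on `ℂ^N`,
`D : M → M` ANY self-map, `π : ℂ^n → M` a holomorphic immersion whose fibres are exactly the cosets of the full lattice
`Φ₀ (ℤ^{2n})` and which intertwines doubling with `D` (`D (π z) = π (2 • z)`), `f : ℂ^n → M` holomorphic with
`f 0 = π 0`, `D (f z) = f (2 • z)`, `range f ⊆ range π`, injective on a ball at `0`.  THEN `f = π ∘ L` for a continuous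
linear automorphism `L` of `ℂ^n` (`exists_linear_of_doubling_equivariant`).

PROOF (no covering-space theory, no power series).  (1) `π` is injective on a small ball (the lattice is discrete:
`injOn_ball_of_ker_lattice`).  (2) Because `M` is Hausdorff and a fundamental parallelotope of the lattice is compact,
`π (ball 0 r)` is a neighbourhood of `π 0` INSIDE `range π`: points `π w` close to `π 0` have a representative `w'` of
`w + Φ₀ ℤ^{2n}` in `ball 0 r` (`exists_nhds_repr_mem_ball`).  (3) `π` is an immersion at `0`, so in the extended chart
`φ` of `M` at `π 0` the map `φ ∘ π` has injective derivative `T`; with a linear retraction `P` of `T`, `ψ := P ∘ φ ∘ π`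
has derivative `id` at `0`, is `C¹` (holomorphic ⇒ `Cⁿ`, ★ `HolomorphicBanach.contDiffOn_of_differentiableOn`
[Chae1985, Thm. 14.13]) hence strictly differentiable, and the inverse function theorem gives a local inverse `χ`;
`σ := χ ∘ P ∘ φ : M → ℂ^n` is a local left inverse of `π` at `0` with `σ ∘ f` differentiable at `0`.  (4) The
normed-space engine ★ `DilationEquivariantGerm.exists_continuousLinearEquiv_eq_comp` [Milnor2006, Thm. 8.2 ∕ Cor. 8.4]
(with `c = 2`): `σ ∘ f` commutes with halving near `0` by `π`-injectivity, so it equals its derivative `L` there,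
`f = π ∘ L` near `0`, everywhere by doubling, and `L` is injective because `f` is injective near `0`.

THEOREMS ONLY (no `def`, no instance, no notation).  HOME-only prep under the LEAD's «P-1 stays printed this ramp»;
count-neutral.

## References
* [Milnor2006] J. Milnor, *Dynamics in One Complex Variable*, 3rd ed., Ann. of Math. Stud. 160 (2006), §8 Thm. 8.2, Cor. 8.4.
* [BirkenhakeLange2004] C. Birkenhake, H. Lange, *Complex Abelian Varieties*, 2nd ed., Grundlehren 302 (2004), §1.2 Prop. 1.2.1.
* [Chae1985] S. B. Chae, *Holomorphy and Calculus in Normed Spaces* (1985), Thm. 14.13.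
-/

noncomputable section

namespace Literature.Geometry.Kaehler.ComplexTorusDoublingEquivariantLift

open Function Set Filter Metric Topology Manifold
open scoped ContDiff

variable {n : ℕ}

/-! ## §1 Lattice bookkeeping in `ℂ^n` -/

/-- Every point of `ℂ^n` has a lattice translate in the image of the closed unit cube (sup norm) under the real frame
`Φ₀`. [cite: BirkenhakeLange2004, §1.1 (fundamental parallelotope of a lattice)] -/
theorem exists_int_translate_mem_image_closedBall (Φ₀ : (Fin n ⊕ Fin n → ℝ) ≃L[ℝ] (Fin n → ℂ)) (x : Fin n → ℂ) :
    ∃ k : Fin n ⊕ Fin n → ℤ, x + Φ₀ (fun i => (k i : ℝ)) ∈ Φ₀ '' closedBall (0 : Fin n ⊕ Fin n → ℝ) 1 := by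
  refine ⟨fun i => -⌊Φ₀.symm x i⌋, ⟨fun i => Int.fract (Φ₀.symm x i), ?_, ?_⟩⟩
  · rw [mem_closedBall_zero_iff, pi_norm_le_iff_of_nonneg zero_le_one]
    intro i
    rw [Real.norm_eq_abs, abs_le]
    exact ⟨by linarith [Int.fract_nonneg (Φ₀.symm x i)], (Int.fract_lt_one _).le⟩
  · have : (fun i => Int.fract (Φ₀.symm x i)) = Φ₀.symm x + fun i => ((-⌊Φ₀.symm x i⌋ : ℤ) : ℝ) := by
      funext i
      simp only [Pi.add_apply, Int.cast_neg, Int.fract]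
      ring
    rw [this, map_add, ContinuousLinearEquiv.apply_symm_apply]

/-- If the fibres of `π : ℂ^n → M` are the cosets of the lattice `Φ₀ (ℤ^{2n})`, then `π` is injective on a small ball.
[cite: BirkenhakeLange2004, §1.1 (a lattice is discrete)] -/
theorem injOn_ball_of_ker_lattice {M : Type*} (π : (Fin n → ℂ) → M) (Φ₀ : (Fin n ⊕ Fin n → ℝ) ≃L[ℝ] (Fin n → ℂ))
    (hker : ∀ z z' : Fin n → ℂ, π z = π z' ↔ ∃ k : Fin n ⊕ Fin n → ℤ, z' = z + Φ₀ (fun i => (k i : ℝ))) :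
    ∃ ρ > 0, InjOn π (ball (0 : Fin n → ℂ) ρ) := by
  set C : ℝ := ‖(Φ₀.symm : (Fin n → ℂ) →L[ℝ] (Fin n ⊕ Fin n → ℝ))‖ with hC
  have hC0 : 0 ≤ C := norm_nonneg _
  refine ⟨1 / (2 * (C + 1)), by positivity, fun z hz z' hz' hzz' => ?_⟩
  obtain ⟨k, hk⟩ := (hker z z').1 hzz'
  set kR : Fin n ⊕ Fin n → ℝ := fun i => (k i : ℝ) with hkR
  -- the lattice vector `Φ₀ kR = z' - z` is short
  have hshort : ‖Φ₀ kR‖ < 1 / (C + 1) := by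
    have h1 : Φ₀ kR = z' - z := by rw [hk]; abel
    rw [h1]
    rw [mem_ball_zero_iff] at hz hz'
    calc ‖z' - z‖ ≤ ‖z'‖ + ‖z‖ := norm_sub_le _ _
      _ < 1 / (2 * (C + 1)) + 1 / (2 * (C + 1)) := add_lt_add hz' hz
      _ = 1 / (C + 1) := by field_simp; ring
  -- hence `kR` itself has sup norm `< 1`
  have hkR1 : ‖kR‖ < 1 := by
    have h2 : ‖kR‖ ≤ C * ‖Φ₀ kR‖ := by
      have := (Φ₀.symm : (Fin n → ℂ) →L[ℝ] (Fin n ⊕ Fin n → ℝ)).le_opNorm (Φ₀ kR)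
      simpa [hC] using this
    calc ‖kR‖ ≤ C * ‖Φ₀ kR‖ := h2
      _ ≤ C * (1 / (C + 1)) := by gcongr
      _ < 1 := by rw [mul_one_div, div_lt_one (by positivity)]; linarith
  -- so every integer coordinate vanishes
  have hk0 : k = 0 := by
    funext i
    have hi : ‖kR i‖ < 1 := lt_of_le_of_lt (norm_le_pi_norm kR i) hkR1
    rw [hkR, Real.norm_eq_abs, ← Int.cast_abs, ← Int.cast_one, Int.cast_lt, Int.abs_lt_one_iff] at hi
    exact hi
  rw [hk, hkR, hk0]
  have h0 : (fun i : Fin n ⊕ Fin n => ((0 : Fin n ⊕ Fin n → ℤ) i : ℝ)) = 0 := by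
    funext i; simp
  rw [h0, map_zero, add_zero]

/-- **Representatives near `0` for points of `range π` near `π 0`.**  `M` Hausdorff, `π : ℂ^n → M` continuous with
fibres the cosets of the lattice `Φ₀ (ℤ^{2n})`.  For every `r > 0` there is an open `V ∋ π 0` such that every `π w ∈ V`
has a representative `w' ∈ ball 0 r`, `π w' = π w` — i.e. `π (ball 0 r)` is a neighbourhood of `π 0` in `range π`
(compactness of the image of the closed unit cube). [cite: BirkenhakeLange2004, §1.1 (the complex torus `ℂ^g ∕ Λ` is compact)] -/
theorem exists_nhds_repr_mem_ball {M : Type*} [TopologicalSpace M] [T2Space M] (π : (Fin n → ℂ) → M)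
    (hπc : Continuous π) (Φ₀ : (Fin n ⊕ Fin n → ℝ) ≃L[ℝ] (Fin n → ℂ))
    (hker : ∀ z z' : Fin n → ℂ, π z = π z' ↔ ∃ k : Fin n ⊕ Fin n → ℤ, z' = z + Φ₀ (fun i => (k i : ℝ)))
    {r : ℝ} (hr : 0 < r) :
    ∃ V : Set M, IsOpen V ∧ π 0 ∈ V ∧ ∀ w : Fin n → ℂ, π w ∈ V → ∃ w' ∈ ball (0 : Fin n → ℂ) r, π w' = π w := by
  -- the compact "far" part of a fundamental domain
  set K : Set (Fin n → ℂ) := Φ₀ '' closedBall (0 : Fin n ⊕ Fin n → ℝ) 1 with hK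
  have hKc : IsCompact K := (isCompact_closedBall _ _).image Φ₀.continuous
  set B : Set (Fin n → ℂ) := {x | ∀ k : Fin n ⊕ Fin n → ℤ, x + Φ₀ (fun i => (k i : ℝ)) ∉ ball (0 : Fin n → ℂ) r}
    with hB
  have hBc : IsClosed B := by
    have : B = ⋂ k : Fin n ⊕ Fin n → ℤ, (fun x => x + Φ₀ (fun i => (k i : ℝ))) ⁻¹' (ball (0 : Fin n → ℂ) r)ᶜ := by
      ext x
      simp only [hB, mem_setOf_eq, mem_iInter, mem_preimage, mem_compl_iff]
    rw [this]
    exact isClosed_iInter fun k => isOpen_ball.isClosed_compl.preimage (continuous_id.add continuous_const)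
  have hAc : IsCompact (K ∩ B) := hKc.inter_right hBc
  have hclosed : IsClosed (π '' (K ∩ B)) := (hAc.image hπc).isClosed
  have hnot : π 0 ∉ π '' (K ∩ B) := by
    rintro ⟨a, ⟨-, haB⟩, hπa⟩
    obtain ⟨k, hk⟩ := (hker a 0).1 hπa
    exact haB k (by rw [← hk]; exact mem_ball_self hr)
  refine ⟨(π '' (K ∩ B))ᶜ, hclosed.isOpen_compl, hnot, fun w hw => ?_⟩
  obtain ⟨k₁, hk₁⟩ := exists_int_translate_mem_image_closedBall Φ₀ w
  set a := w + Φ₀ (fun i => (k₁ i : ℝ)) with ha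
  have hπa : π w = π a := (hker w a).2 ⟨k₁, rfl⟩
  have haB : a ∉ B := fun h => hw ⟨a, ⟨hk₁, h⟩, hπa.symm⟩
  simp only [hB, mem_setOf_eq, not_forall, not_not] at haB
  obtain ⟨k₂, hk₂⟩ := haB
  exact ⟨a + Φ₀ (fun i => (k₂ i : ℝ)), hk₂, ((hker a _).2 ⟨k₂, rfl⟩).symm.trans hπa.symm⟩

/-! ## §2 The theorem -/

/-- **Doubling-equivariant holomorphic maps factor linearly through a lattice-periodic holomorphic immersion**
(statement of record: organ `DBLADD` of the road-B skeleton for the relative exponential, binder for binder).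
`M` Hausdorff complex manifold on `ℂ^N`; `D : M → M`; `π : ℂ^n → M` holomorphic immersion with fibres the cosets of
`Φ₀ (ℤ^{2n})` and `D (π z) = π (2 • z)`; `f : ℂ^n → M` holomorphic, `f 0 = π 0`, `D (f z) = f (2 • z)`,
`range f ⊆ range π`, injective on some ball at `0`.  Then `f = π ∘ L` for some `L : ℂ^n ≃L[ℂ] ℂ^n`.
[cite: Milnor2006, §8 Thm. 8.2 (Koenigs linearisation, uniqueness clause) and Cor. 8.4]
[cite: BirkenhakeLange2004, §1.2 Prop. 1.2.1] -/
theorem exists_linear_of_doubling_equivariant (n N : ℕ) (M : Type) [TopologicalSpace M] [T2Space M]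
    [ChartedSpace (Fin N → ℂ) M] [IsManifold 𝓘(ℂ, Fin N → ℂ) ω M]
    (D : M → M) (π f : (Fin n → ℂ) → M) (Φ₀ : (Fin n ⊕ Fin n → ℝ) ≃L[ℝ] (Fin n → ℂ))
    (hπ : MDifferentiable 𝓘(ℂ, Fin n → ℂ) 𝓘(ℂ, Fin N → ℂ) π)
    (hπimm : ∀ z : Fin n → ℂ, Injective (mfderiv 𝓘(ℂ, Fin n → ℂ) 𝓘(ℂ, Fin N → ℂ) π z))
    (hker : ∀ z z' : Fin n → ℂ, π z = π z' ↔ ∃ k : Fin n ⊕ Fin n → ℤ, z' = z + Φ₀ (fun i => (k i : ℝ)))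
    (hπD : ∀ z : Fin n → ℂ, D (π z) = π ((2 : ℂ) • z))
    (hf : MDifferentiable 𝓘(ℂ, Fin n → ℂ) 𝓘(ℂ, Fin N → ℂ) f)
    (hf0 : f 0 = π 0)
    (hfD : ∀ z : Fin n → ℂ, D (f z) = f ((2 : ℂ) • z))
    (hrange : ∀ z : Fin n → ℂ, ∃ w : Fin n → ℂ, f z = π w)
    (hfinj : ∃ ρ > 0, InjOn f (Metric.ball (0 : Fin n → ℂ) ρ)) :
    ∃ L : (Fin n → ℂ) ≃L[ℂ] (Fin n → ℂ), ∀ z : Fin n → ℂ, f z = π (L z) := by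
  -- notation
  have hc : 1 < ‖(2 : ℂ)‖ := by norm_num
  have hπD' : ∀ z : Fin n → ℂ, π ((2 : ℂ) • z) = D (π z) := fun z => (hπD z).symm
  have hfD' : ∀ z : Fin n → ℂ, f ((2 : ℂ) • z) = D (f z) := fun z => (hfD z).symm
  have hπc : Continuous π := hπ.continuous
  have hfc : Continuous f := hf.continuous
  -- (1) `π` is injective on a small ball
  obtain ⟨ρ₁, hρ₁, hinj⟩ := injOn_ball_of_ker_lattice π Φ₀ hker
  -- (3) the extended chart of `M` at `π 0` and the chart expressions of `π` and `f`
  set φ := extChartAt 𝓘(ℂ, Fin N → ℂ) (π 0) with hφ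
  have hsrc : IsOpen (chartAt (Fin N → ℂ) (π 0)).source := (chartAt (Fin N → ℂ) (π 0)).open_source
  have hmem0 : π 0 ∈ (chartAt (Fin N → ℂ) (π 0)).source := mem_chart_source _ _
  set U : Set (Fin n → ℂ) := π ⁻¹' (chartAt (Fin N → ℂ) (π 0)).source with hU
  have hUo : IsOpen U := hsrc.preimage hπc
  have h0U : (0 : Fin n → ℂ) ∈ U := hmem0
  set g : (Fin n → ℂ) → (Fin N → ℂ) := φ ∘ π with hg
  have hgmd : ∀ x ∈ U, MDifferentiableAt 𝓘(ℂ, Fin n → ℂ) 𝓘(ℂ, Fin N → ℂ) g x := fun x hx =>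
    (mdifferentiableAt_extChartAt hx).comp x (hπ x)
  have hgd : DifferentiableOn ℂ g U := fun x hx => (hgmd x hx).differentiableAt.differentiableWithinAt
  have hgC : ContDiffOn ℂ (1 : ℕ∞) g U :=
    Literature.Analysis.Complex.HolomorphicBanach.contDiffOn_of_differentiableOn hgd hUo
  have hgCat : ContDiffAt ℂ (1 : ℕ∞) g 0 := hgC.contDiffAt (hUo.mem_nhds h0U)
  have hgstrict : HasStrictFDerivAt g (fderiv ℂ g 0) 0 :=
    hgCat.hasStrictFDerivAt (by norm_num)
  set T : (Fin n → ℂ) →L[ℂ] (Fin N → ℂ) := fderiv ℂ g 0 with hT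
  -- `T` is injective: chart derivative (invertible) after `mfderiv π 0` (injective)
  have hTinj : Injective T := by
    have h1 : mfderiv 𝓘(ℂ, Fin n → ℂ) 𝓘(ℂ, Fin N → ℂ) g 0 = T := mfderiv_eq_fderiv
    have h2 : mfderiv 𝓘(ℂ, Fin n → ℂ) 𝓘(ℂ, Fin N → ℂ) g 0 =
        (mfderiv 𝓘(ℂ, Fin N → ℂ) 𝓘(ℂ, Fin N → ℂ) φ (π 0)).comp
          (mfderiv 𝓘(ℂ, Fin n → ℂ) 𝓘(ℂ, Fin N → ℂ) π 0) :=
      mfderiv_comp 0 (mdifferentiableAt_extChartAt hmem0) (hπ 0)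
    have hmem0' : π 0 ∈ (extChartAt 𝓘(ℂ, Fin N → ℂ) (π 0)).source := by
      rwa [extChartAt_source]
    obtain ⟨e, he⟩ := isInvertible_mfderiv_extChartAt (I := 𝓘(ℂ, Fin N → ℂ)) hmem0'
    rw [← h1, h2, ← he]
    exact e.injective.comp (hπimm 0)
  -- a linear retraction `P` of `T`
  obtain ⟨Pl, hPl⟩ := LinearMap.exists_leftInverse_of_injective (T : (Fin n → ℂ) →ₗ[ℂ] (Fin N → ℂ))
    (LinearMap.ker_eq_bot.mpr hTinj)
  set P : (Fin N → ℂ) →L[ℂ] (Fin n → ℂ) := LinearMap.toContinuousLinearMap Pl with hP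
  have hPT : ∀ v, P (T v) = v := fun v => by
    have := LinearMap.congr_fun hPl v
    simpa [hP] using this
  -- `ψ := P ∘ g` has derivative `id` at `0`; inverse function theorem
  set ψ : (Fin n → ℂ) → (Fin n → ℂ) := P ∘ g with hψ
  have hψstrict : HasStrictFDerivAt ψ
      ((ContinuousLinearEquiv.refl ℂ (Fin n → ℂ) : (Fin n → ℂ) ≃L[ℂ] (Fin n → ℂ)) :
        (Fin n → ℂ) →L[ℂ] (Fin n → ℂ)) 0 := by
    have h := P.hasStrictFDerivAt.comp 0 hgstrict
    have hPT' : P.comp T = ((ContinuousLinearEquiv.refl ℂ (Fin n → ℂ) : (Fin n → ℂ) ≃L[ℂ] (Fin n → ℂ)) :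
        (Fin n → ℂ) →L[ℂ] (Fin n → ℂ)) := by
      ext v i
      simp [hPT]
    rwa [hPT'] at h
  set χ := hψstrict.localInverse ψ _ 0 with hχ
  have hχleft : ∀ᶠ x in 𝓝 (0 : Fin n → ℂ), χ (ψ x) = x := hψstrict.eventually_left_inverse
  have hχderiv : HasFDerivAt χ
      (((ContinuousLinearEquiv.refl ℂ (Fin n → ℂ)).symm : (Fin n → ℂ) ≃L[ℂ] (Fin n → ℂ)) :
        (Fin n → ℂ) →L[ℂ] (Fin n → ℂ)) (ψ 0) :=
    hψstrict.to_localInverse.hasFDerivAt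
  -- the local left inverse `σ` of `π`
  set σ : M → (Fin n → ℂ) := fun m => χ (P (φ m)) with hσ
  have hσπ : ∀ᶠ x in 𝓝 (0 : Fin n → ℂ), σ (π x) = x := by
    filter_upwards [hχleft] with x hx
    simpa [hσ, hψ, hg] using hx
  obtain ⟨r₀, hr₀, hσπ'⟩ : ∃ r₀ > 0, ∀ x ∈ ball (0 : Fin n → ℂ) r₀, σ (π x) = x :=
    Metric.eventually_nhds_iff_ball.mp hσπ
  -- (2) representatives: `f` of a small ball lands in `π (ball 0 r₀)`
  obtain ⟨V, hVo, hV0, hVrep⟩ := exists_nhds_repr_mem_ball π hπc Φ₀ hker hr₀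
  obtain ⟨r, hr, hrV⟩ : ∃ r > 0, ∀ w ∈ ball (0 : Fin n → ℂ) r, f w ∈ V := by
    have : f ⁻¹' V ∈ 𝓝 (0 : Fin n → ℂ) := hfc.continuousAt.preimage_mem_nhds (by rw [hf0]; exact hVo.mem_nhds hV0)
    obtain ⟨r, hr, hsub⟩ := Metric.mem_nhds_iff.mp this
    exact ⟨r, hr, fun w hw => hsub hw⟩
  have hσf : ∀ w ∈ ball (0 : Fin n → ℂ) r, π (σ (f w)) = f w := by
    intro w hw
    obtain ⟨w₁, hw₁⟩ := hrange w
    obtain ⟨w', hw', hπw'⟩ := hVrep w₁ (by rw [← hw₁]; exact hrV w hw)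
    rw [hw₁, ← hπw', hσπ' w' hw']
  have hσ0 : σ (f 0) = 0 := by rw [hf0]; exact hσπ' 0 (mem_ball_self hr₀)
  -- `σ ∘ f` is differentiable at `0`
  set h : (Fin n → ℂ) → (Fin N → ℂ) := φ ∘ f with hh
  have hhd : DifferentiableAt ℂ h 0 := by
    have hmemf : f 0 ∈ (chartAt (Fin N → ℂ) (π 0)).source := by rw [hf0]; exact hmem0
    exact ((mdifferentiableAt_extChartAt hmemf).comp 0 (hf 0)).differentiableAt
  have hbase : P (h 0) = ψ 0 := by simp [hh, hψ, hg, hf0]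
  have hL : HasFDerivAt (σ ∘ f)
      ((((ContinuousLinearEquiv.refl ℂ (Fin n → ℂ)).symm : (Fin n → ℂ) ≃L[ℂ] (Fin n → ℂ)) :
        (Fin n → ℂ) →L[ℂ] (Fin n → ℂ)).comp (P.comp (fderiv ℂ h 0))) 0 := by
    have h1 : HasFDerivAt (fun x => P (h x)) (P.comp (fderiv ℂ h 0)) 0 := P.hasFDerivAt.comp 0 hhd.hasFDerivAt
    have h2 : HasFDerivAt χ
        (((ContinuousLinearEquiv.refl ℂ (Fin n → ℂ)).symm : (Fin n → ℂ) ≃L[ℂ] (Fin n → ℂ)) :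
          (Fin n → ℂ) →L[ℂ] (Fin n → ℂ)) (P (h 0)) := by rw [hbase]; exact hχderiv
    have h3 := h2.comp 0 h1
    exact h3
  -- (4) the normed-space engine with `c = 2`
  obtain ⟨ρf, hρf, hfinj'⟩ := hfinj
  obtain ⟨L', -, hfac⟩ :=
    Literature.Analysis.Calculus.DilationEquivariantGerm.exists_continuousLinearEquiv_eq_comp (𝕜 := ℂ)
      hc hπD' hfD' hρ₁ hr hinj hσf hσ0 hL hρf hfinj'
  exact ⟨L', fun z => congrFun hfac z⟩

end Literature.Geometry.Kaehler.ComplexTorusDoublingEquivariantLift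

end
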